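import Summits.NavierStokesRegularity.NavierStokesRegularity.Theorems.SoloRefuteSmith2006

/-!
# D-0090 NS-CLAIMS, claim C06 `Smith2006` (#14) — support decl: the imported comparison principle
[Sm3] Thm 4 (printed generality, classical comparands) is false

Cell `ns-claims`; refuter `ns-claims-refuter-4` (g3). Records-grade kernel object on the SUPPORT decls
`Literature.Claims.NS.Smith2006.Sm3Theorem4General` / `Sm3Theorem4GeneralFlipped` (= `Sm3ComparisonShape 1`
/ `Sm3ComparisonShape (-1)`): the comparison principle of P. Smith, «Perron's method for general
quasilinear symmetric hyperbolic systems …», arXiv:math/0605352 v4 ([Sm3] of the claim), Thm 4 p. 10 (with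
Thm 1 p. 2 and the Remark p. 11 placing classical `C²` fields with the residual sign among the viscosity
sub/supersolutions), in the generality of its Defs 1–3 p. 2 (`A⁰ > 0` and `Aⁱ` symmetric smooth, `B`
smooth, `f` smooth, `n ≥ 3` odd), restricted to classical comparands as typed. The token / locator / class
of #14 are unaffected (support decl, MAP-SCHEMA §1b).

## Countermodel
`n = 3`, `N = 2`, `A⁰ = 1`, `Aⁱ = 0`, `B(u) = (−u₁, u₀)` (rotation generator, linear), `f = 0`, slab
`S = [0, 1]`, data `w₀ = 0`, `u₁ = 0` (residual `0`), and `u₂(t, x) = (t²/2·φ(x), −t·φ(x))` with `φ` the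
bump `β` (`0 ≤ φ ≤ 1`, `φ(0) = 1`, support in `‖x‖ ≤ 2`): `L(u₂) = ∂ₜu₂ − B(u₂) = (tφ − tφ, −φ − t²φ/2)
= (0, −(1 + t²/2)φ) ≤ 0`, so `u₂` is a classical subsolution with the same data as the supersolution
`u₁ = 0`; but `u₂(1, 0)₀ = 1/2 > 0 = u₁`. For the literal-sign variant take `u₂ = (t²/2·φ, t·φ)`:
`L(u₂) = (2tφ, (1 − t²/2)φ) ≥ 0` on `[0, 1]`. (A first-order system with a non-cooperative coupling has
no componentwise comparison principle — already for ODEs.)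

WHAT THIS IS NOT: not a claim about NS regularity or blow-up; not a claim about any author beyond the typed
locator.
-/

-- The summit's canonical theorem namespace repeats the summit name (single-conjunct summit).
set_option linter.dupNamespace false

noncomputable section

open Set Function MeasureTheory Metric
open scoped ContDiff ENNReal Topology

namespace Summit.NavierStokesRegularity.NavierStokesRegularity.Theorems.Smith2006.Sm3

open Literature.Claims.NS.Smith2006

/-- Value type of the countermodel system (`N = 2`). -/
abbrev V2 : Type := Fin 2 → ℝ

/-- Coefficient matrices: `A⁰ = 1`, `A¹ = A² = A³ = 0`. -/
def A (α : Fin 4) (_t : ℝ) (_x : R3) (_z : V2) : Matrix (Fin 2) (Fin 2) ℝ := if α = 0 then 1 else 0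

/-- Zeroth-order term: the rotation generator `B(u) = (−u₁, u₀)`. -/
def B (u : V2) : V2 := ![-(u 1), u 0]

/-- Forcing `f = 0`. -/
def f (_t : ℝ) (_x : R3) : V2 := 0

/-- The spatial profile: the bump `β` (`= 1` on `‖x‖ ≤ 1`, `= 0` off `‖x‖ < 2`). -/
abbrev φ : R3 → ℝ := β

/-- The subsolution of the countermodel, sign parameter `σ`: `u_σ(t, x) = (t²/2·φ(x), σ·t·φ(x))`. -/
def usub (σ : ℝ) (t : ℝ) (x : R3) : V2 := ![t ^ 2 / 2 * φ x, σ * (t * φ x)]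

/-- The supersolution `u₁ = 0`. -/
def uzero (_t : ℝ) (_x : R3) : V2 := 0

/-! ### The residuals -/

/-- `∂ₜ u_σ(·, x)` within `[0, 1]`. [folklore] -/
theorem derivWithin_usub (σ : ℝ) {t : ℝ} (ht : t ∈ Icc (0 : ℝ) 1) (x : R3) :
    derivWithin (fun s => usub σ s x) (Icc 0 1) t = ![t * φ x, σ * φ x] := by
  have h : HasDerivAt (fun s => usub σ s x) ![t * φ x, σ * φ x] t := by
    refine hasDerivAt_pi.2 fun c => ?_
    fin_cases c
    · have h1 : HasDerivAt (fun s : ℝ => s ^ 2 / 2 * φ x) (((2 : ℕ) * t ^ (2 - 1)) / 2 * φ x) t :=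
        ((hasDerivAt_pow 2 t).div_const 2).mul_const _
      simpa [usub] using h1.congr_deriv (by ring)
    · have h1 : HasDerivAt (fun s : ℝ => σ * (s * φ x)) (σ * (1 * φ x)) t :=
        ((hasDerivAt_id t).mul_const _).const_mul σ
      simpa [usub] using h1
  exact h.hasDerivWithinAt.derivWithin (uniqueDiffOn_Icc one_pos t ht)

/-- The residual of `u_σ`: `L(u_σ)(t, x) = ((1 + σ)tφ, (σ − t²/2)φ)`. [folklore] -/
theorem residual_usub (σ : ℝ) {t : ℝ} (ht : t ∈ Icc (0 : ℝ) 1) (x : R3) :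
    sm3Residual A B f (Icc 0 1) (usub σ) t x = ![(1 + σ) * (t * φ x), (σ - t ^ 2 / 2) * φ x] := by
  unfold sm3Residual
  rw [derivWithin_usub σ ht x]
  ext c
  fin_cases c <;> simp [A, B, f, usub, Fin.succ_ne_zero] <;> ring

/-- The residual of `u₁ = 0` vanishes. [folklore] -/
theorem residual_uzero (t : ℝ) (x : R3) : sm3Residual A B f (Icc 0 1) uzero t x = 0 := by
  unfold sm3Residual
  ext c
  fin_cases c <;> simp [A, B, f, uzero, Fin.succ_ne_zero]

/-! ### Regularity, integrability, bounds -/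

/-- `u_σ` is smooth on `ℝ × ℝ³`. [folklore] -/
theorem contDiff_usub (σ : ℝ) : ContDiff ℝ 2 (uncurry (usub σ)) := by
  have hφ : ContDiff ℝ 2 fun q : ℝ × R3 => φ q.2 := β.contDiff.comp contDiff_snd
  have h0 : ContDiff ℝ 2 fun q : ℝ × R3 => q.1 ^ 2 / 2 * φ q.2 :=
    ((contDiff_fst.pow 2).div_const 2).mul hφ
  have h1 : ContDiff ℝ 2 fun q : ℝ × R3 => σ * (q.1 * φ q.2) := contDiff_const.mul (contDiff_fst.mul hφ)
  have hu : uncurry (usub σ) = fun q : ℝ × R3 => ![q.1 ^ 2 / 2 * φ q.2, σ * (q.1 * φ q.2)] := by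
    funext q; rfl
  rw [hu]
  refine contDiff_pi.2 fun c => ?_
  fin_cases c
  · simpa using h0
  · simpa using h1

/-- `0 ≤ φ ≤ 1`. [folklore] -/
theorem abs_φ_le (x : R3) : |φ x| ≤ 1 := abs_le.2 ⟨by linarith [β.nonneg (x := x)], β.le_one⟩

/-- `‖u_σ(t, x)‖ ≤ 1/2 + |σ|` for `t ∈ [0, 1]` and `u_σ(t, x) = 0` for `‖x‖ > 2`. [folklore] -/
theorem norm_usub_le (σ : ℝ) {t : ℝ} (ht : t ∈ Icc (0 : ℝ) 1) (x : R3) :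
    ‖usub σ t x‖ ≤ 1 / 2 + |σ| := by
  obtain ⟨ht0, ht1⟩ := ht
  have hφ := abs_φ_le x
  have hφ0 : 0 ≤ |φ x| := abs_nonneg _
  refine (pi_norm_le_iff_of_nonneg (by positivity)).2 fun c => ?_
  fin_cases c
  · simp only [usub, Fin.zero_eta, Matrix.cons_val_zero, Real.norm_eq_abs, abs_mul]
    rw [abs_of_nonneg (by positivity : (0 : ℝ) ≤ t ^ 2 / 2)]
    nlinarith [abs_nonneg σ]
  · simp only [usub, Fin.mk_one, Matrix.cons_val_one, Matrix.cons_val_fin_one, Real.norm_eq_abs, abs_mul]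
    rw [abs_of_nonneg ht0]
    have h1 : t * |φ x| ≤ 1 := by nlinarith
    calc |σ| * (t * |φ x|) ≤ |σ| * 1 := mul_le_mul_of_nonneg_left h1 (abs_nonneg σ)
      _ ≤ 1 / 2 + |σ| := by linarith [abs_nonneg σ]

/-- `u_σ(t, x) = 0` for `‖x‖ ≥ 2`. [folklore] -/
theorem usub_zero_of (σ t : ℝ) {x : R3} (hx : 2 ≤ ‖x‖) : usub σ t x = 0 := by
  have hφ : φ x = 0 := β.zero_of_le_dist (by simpa [β] using hx)
  ext c
  fin_cases c <;> simp [usub, hφ]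

/-- `u_σ` is integrable on the slab `[0, 1] × ℝ³` (bounded with bounded support). [folklore] -/
theorem lintegral_usub_lt_top (σ : ℝ) :
    ∫⁻ q in Icc (0 : ℝ) 1 ×ˢ (univ : Set R3), ‖uncurry (usub σ) q‖ₑ < ⊤ := by
  set K : Set (ℝ × R3) := Icc 0 1 ×ˢ closedBall (0 : R3) 2 with hK_def
  have hKc : IsCompact K := isCompact_Icc.prod (isCompact_closedBall _ _)
  have hKm : MeasurableSet K := measurableSet_Icc.prod measurableSet_closedBall
  have hbd : ∀ q ∈ Icc (0 : ℝ) 1 ×ˢ (univ : Set R3),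
      ‖uncurry (usub σ) q‖ₑ ≤ K.indicator (fun _ => ENNReal.ofReal (1 / 2 + |σ|)) q := by
    rintro ⟨t, x⟩ ⟨ht, -⟩
    by_cases hx : 2 ≤ ‖x‖
    · simp [uncurry, usub_zero_of σ t hx]
    · have hq : (t, x) ∈ K := ⟨ht, mem_closedBall_zero_iff.2 (not_le.1 hx).le⟩
      rw [indicator_of_mem hq, ← ofReal_norm]
      exact ENNReal.ofReal_le_ofReal (norm_usub_le σ ht x)
  calc ∫⁻ q in Icc (0 : ℝ) 1 ×ˢ (univ : Set R3), ‖uncurry (usub σ) q‖ₑ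
      ≤ ∫⁻ q in Icc (0 : ℝ) 1 ×ˢ (univ : Set R3), K.indicator (fun _ => ENNReal.ofReal (1 / 2 + |σ|)) q :=
        setLIntegral_mono' (measurableSet_Icc.prod MeasurableSet.univ) hbd
    _ = ENNReal.ofReal (1 / 2 + |σ|) * volume.restrict (Icc (0 : ℝ) 1 ×ˢ (univ : Set R3)) K :=
        lintegral_indicator_const hKm _
    _ ≤ ENNReal.ofReal (1 / 2 + |σ|) * volume K := by gcongr; exact Measure.restrict_le_self
    _ < ⊤ := ENNReal.mul_lt_top (by simp) hKc.measure_lt_top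

/-! ### The refutations -/

/-- The typed shape fails for both sign placements: `σ = −1` serves `sgn = 1`, `σ = 1` serves `sgn = −1`. -/
theorem not_Sm3ComparisonShape {sgn σ : ℝ} (hσ : σ = 1 ∨ σ = -1) (hsgn : sgn = -σ) :
    ¬ Sm3ComparisonShape sgn := by
  intro h
  have hS : IsTimeSlab 0 (Icc (0 : ℝ) 1) := Or.inl ⟨1, one_pos, rfl⟩
  have hw₀ : ∀ k : ℕ, ∫⁻ x, ‖iteratedFDeriv ℝ k (fun _ : R3 => (0 : V2)) x‖ₑ ^ 2 < ⊤ := by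
    intro k
    simp
  have hB : ContDiff ℝ ∞ B := by
    refine contDiff_pi.2 fun c => ?_
    fin_cases c
    · simpa [B] using (contDiff_apply ℝ ℝ (1 : Fin 2)).neg
    · simpa [B] using contDiff_apply ℝ ℝ (0 : Fin 2)
  have key := h 3 2 ⟨1, rfl⟩ le_rfl A B f
    (fun α t x z => by unfold A; split_ifs <;> simp [Matrix.IsSymm])
    (fun t x z => by simpa [A] using Matrix.PosDef.one)
    (fun α i j => contDiff_const) hB contDiff_const (Icc 0 1) hS (fun _ => 0) contDiff_const hw₀
    uzero (usub σ) contDiff_const.contDiffOn (contDiff_usub σ).contDiffOn (by simp [uncurry, uzero])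
    (lintegral_usub_lt_top σ) ⟨1 / 2 + |σ|, fun t ht x => ⟨by simp [uzero]; positivity, norm_usub_le σ ht x⟩⟩
    (fun t _ x c => by rw [residual_uzero]; simp)
    (fun t ht x c => by
      rw [residual_usub σ ht x]
      have hφ : 0 ≤ φ x := β.nonneg
      obtain ⟨ht0, ht1⟩ := ht
      have hφt : 0 ≤ t * φ x := mul_nonneg ht0 hφ
      have hA : 0 ≤ (1 - t ^ 2 / 2) * φ x := mul_nonneg (by nlinarith) hφ
      have hB : (-1 - t ^ 2 / 2) * φ x ≤ 0 := mul_nonpos_of_nonpos_of_nonneg (by nlinarith) hφ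
      rcases hσ with rfl | rfl
      · subst hsgn
        fin_cases c
        · simp
          nlinarith
        · simp
          nlinarith
      · subst hsgn
        fin_cases c
        · simp
        · simp
          nlinarith)
    (by funext x; ext c; fin_cases c <;> simp [uzero])
    (by funext x; ext c; fin_cases c <;> simp [usub])
  have h1 := key 1 ⟨zero_le_one, le_rfl⟩ 0 0
  simp [usub, uzero, β_zero] at h1
  norm_num at h1

/-- **[Sm3] Thm 4 in printed generality (classical comparands, convention `L(u₁) ≥ 0` on top) is false**:
rotation-coupled `2 × 2` system, `u₁ = 0` versus `u₂ = (t²φ/2, −tφ)`.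
[cite: Smith2006PerronGeneral, Thm 4 p.10 with Thm 1 p.2, Defs 1–3 p.2] -/
theorem not_Sm3Theorem4General : ¬ Sm3Theorem4General :=
  not_Sm3ComparisonShape (σ := -1) (Or.inr rfl) (by norm_num)

/-- **The literal-sign variant of [Sm3] Thm 4 p. 10 is false as well**: `u₁ = 0` versus `u₂ = (t²φ/2, tφ)`.
[cite: Smith2006PerronGeneral, Thm 4 p.10] -/
theorem not_Sm3Theorem4GeneralFlipped : ¬ Sm3Theorem4GeneralFlipped :=
  not_Sm3ComparisonShape (σ := 1) (Or.inl rfl) (by norm_num)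

end Summit.NavierStokesRegularity.NavierStokesRegularity.Theorems.Smith2006.Sm3

end
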